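import Mathlib
import HarnessLib
import Literature.Probability.LatticeModels.IsingConsistency
import Summits.CriticalPhenomena.Ising3DConformalLimit.Theses.PlantedPinning
import Summits.CriticalPhenomena.Ising3DConformalLimit.Theorems.PlantedPinningPinningEfficiencyLeOnePinningLemma
import Summits.CriticalPhenomena.Ising3DConformalLimit.Theorems.PlantedPinningPinningEfficiencyLeOneDLR

/-!
# `PinningEfficiencyLeOne` — the pinning-lemma ceiling for the planted critical Ising box
(route `PlantedPinning`, support item stmt-CriticalPhenomena-8455: PROOF)

For every `L` and `1 ≤ k ≤ n = |box 3 L|`, the planted pinning efficiency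
`e_L(k) = k · v_{L,k} / ((n+1)(n−k+1))` of the critical `+`-boundary Ising box on `ℤ³` lies in
`[0, 1]` (`pinningEfficiencyLeOne_proof`, literally the route decl), where `v_{L,k}` is the
conditional variance of the total spin given the planted values on a uniformly random `k`-subset
`P`, averaged over `P` and over the planted configuration, the conditional law being the Ising
measure on `box 3 L ∖ P` with boundary condition fixed to the planted pattern glued into `+`.

Proof (`pinning_efficiency_bounds`, any locally finite graph, volume, `β`, `h`, fixed boundary
condition): the finite-volume DLR identity (`sum_kernel_isingWeight_eq`) identifies the planted
conditional variance with the expected conditional variance `𝔼 Var(M | σ|_P)` of the finite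
weighted spin system `(patterns on Λ, w = Boltzmann weight / Z)`, to which the abstract pinning
lemma `pinning_lemma` (Montanari 2008; Raghavendra–Tan 2012) applies: `k v_k ≤ (n+1)(n−k+1)`;
nonnegativity is conditional Jensen (`vbar_nonneg`).  No definitions, no named facts.
-/

namespace Summit.CriticalPhenomena.Ising3DConformalLimit.PlantedPinningCeiling

open Finset MeasureTheory Literature.Probability.LatticeModels
open Summit.CriticalPhenomena.Ising3DConformalLimit.Theses.PlantedPinning

/-- **Planted pinning efficiency lies in `[0,1]`** for the finite-volume Ising model on any
locally finite graph, any volume `Λ`, any `β, h` and any fixed boundary condition `η₀`: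
with `n = |Λ|`, `w = w^{η₀}_Λ / Z^{η₀}_Λ` and
`v_k = (n choose k)⁻¹ ∑_{|P| = k} ∑_τ w(τ) Var^{τ ∨ η₀}_{Λ ∖ P}(∑_{x ∈ Λ} σ_x)`,
`0 ≤ k v_k / ((n+1)(n−k+1)) ≤ 1` for `k ≤ n` (pinning lemma: Montanari 2008, arXiv:0709.0145;
Raghavendra–Tan 2012; finite-volume DLR: Friedli–Velenik 2017, Lemma 6.7). [folklore] -/
theorem pinning_efficiency_bounds {V : Type*} [DecidableEq V] (G : SimpleGraph V) [G.LocallyFinite]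
    (Λ : Finset V) (β h : ℝ) (η₀ : SpinConfig V) {k : ℕ} (hkn : k ≤ #Λ) :
    0 ≤ (k : ℝ) * ((∑ P ∈ Λ.powersetCard k, ∑ τ : Λ → ℤˣ,
        isingWeight G Λ β h (.fixed η₀) τ / isingPartitionFunction G Λ β h (.fixed η₀) *
          (isingExpect G (Λ \ P) β h (.fixed (glue Λ τ (.fixed η₀)))
              (fun σ => (∑ x ∈ Λ, spinAt x σ) ^ 2) -
            isingExpect G (Λ \ P) β h (.fixed (glue Λ τ (.fixed η₀)))
              (fun σ => ∑ x ∈ Λ, spinAt x σ) ^ 2)) / ((#Λ).choose k : ℝ)) /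
        (((#Λ : ℝ) + 1) * ((#Λ : ℝ) - k + 1)) ∧
    (k : ℝ) * ((∑ P ∈ Λ.powersetCard k, ∑ τ : Λ → ℤˣ,
        isingWeight G Λ β h (.fixed η₀) τ / isingPartitionFunction G Λ β h (.fixed η₀) *
          (isingExpect G (Λ \ P) β h (.fixed (glue Λ τ (.fixed η₀)))
              (fun σ => (∑ x ∈ Λ, spinAt x σ) ^ 2) -
            isingExpect G (Λ \ P) β h (.fixed (glue Λ τ (.fixed η₀)))
              (fun σ => ∑ x ∈ Λ, spinAt x σ) ^ 2)) / ((#Λ).choose k : ℝ)) /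
        (((#Λ : ℝ) + 1) * ((#Λ : ℝ) - k + 1)) ≤ 1 := by
  classical
  -- weights `w = w^{η₀}_Λ / Z`
  set W : (Λ → ℤˣ) → ℝ := isingWeight G Λ β h (.fixed η₀) with hW
  set Z : ℝ := isingPartitionFunction G Λ β h (.fixed η₀) with hZ
  have hZpos : 0 < Z := isingPartitionFunction_pos G Λ β h (.fixed η₀)
  set w : (Λ → ℤˣ) → ℝ := fun τ => W τ / Z with hw
  have hwpos : ∀ τ, 0 < w τ := fun τ => div_pos (isingWeight_pos G Λ β h _ τ) hZpos
  have hw1 : ∑ τ, w τ = 1 := by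
    simp only [hw]
    rw [← Finset.sum_div, div_eq_one_iff_eq hZpos.ne']
    rfl
  -- spins `s x τ = (τ ∨ η₀)_x`
  set s : V → (Λ → ℤˣ) → ℝ := fun x τ => spinAt x (glue Λ τ (.fixed η₀)) with hs
  have hs1 : ∀ x τ, s x τ ^ 2 = 1 := fun x τ => spinAt_sq x _
  -- agreement kernels and conditional expectations given the spins on `P`
  set K : Finset V → (Λ → ℤˣ) → (Λ → ℤˣ) → ℝ :=
    fun P a b => if ∀ x ∈ P, s x a = s x b then 1 else 0 with hK
  have hK1 : ∀ P a b, (∀ x ∈ P, s x a = s x b) → K P a b = 1 := fun P a b hab => by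
    simp only [hK, if_pos hab]
  have hK0 : ∀ P a b, ¬ (∀ x ∈ P, s x a = s x b) → K P a b = 0 := fun P a b hab => by
    simp only [hK, if_neg hab]
  set E : Finset V → ((Λ → ℤˣ) → ℝ) → (Λ → ℤˣ) → ℝ :=
    fun P g τ => (∑ σ, K P τ σ * w σ * g σ) / ∑ σ, K P τ σ * w σ with hE
  have hEeq : ∀ P g τ, E P g τ = (∑ σ, K P τ σ * w σ * g σ) / ∑ σ, K P τ σ * w σ :=
    fun _ _ _ => rfl
  set Mt : (Λ → ℤˣ) → ℝ := fun τ => ∑ x ∈ Λ, s x τ with hMt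
  have hMeq : ∀ τ, Mt τ = ∑ x ∈ Λ, s x τ := fun _ => rfl
  -- the abstract pinning lemma and nonnegativity of expected conditional variances
  have hmain := pinning_lemma w s Λ hK1 hK0 hEeq hwpos hw1 hs1 hMeq hkn
  have hnonneg : ∀ P, 0 ≤ ∑ τ, w τ * (E P (fun τ => Mt τ ^ 2) τ - (E P Mt τ) ^ 2) := fun P => by
    obtain ⟨_, h01, hrefl, _, _⟩ := agreeKernel_props s hK1 hK0 P
    exact vbar_nonneg w (K P) (hEeq P) hwpos h01 hrefl Mt
  -- DLR: the planted conditional variance is the conditional variance given the spins on `P`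
  have hcv : ∀ P, P ⊆ Λ → ∀ τ : Λ → ℤˣ,
      isingExpect G (Λ \ P) β h (.fixed (glue Λ τ (.fixed η₀))) (fun σ => (∑ x ∈ Λ, spinAt x σ) ^ 2) -
        isingExpect G (Λ \ P) β h (.fixed (glue Λ τ (.fixed η₀))) (fun σ => ∑ x ∈ Λ, spinAt x σ) ^ 2 =
      E P (fun τ => Mt τ ^ 2) τ - (E P Mt τ) ^ 2 := by
    intro P hP τ
    obtain ⟨_, h01, hrefl, _, _⟩ := agreeKernel_props s hK1 hK0 P
    have hm1 : Measurable (fun σ : SpinConfig V => ∑ x ∈ Λ, spinAt x σ) :=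
      Finset.measurable_sum _ fun x _ => measurable_spinAt x
    have hm2 : Measurable (fun σ : SpinConfig V => (∑ x ∈ Λ, spinAt x σ) ^ 2) := hm1.pow_const 2
    have hKW : 0 < ∑ σ, K P τ σ * W σ :=
      ksum_one_pos W (K P) (fun σ => isingWeight_pos G Λ β h _ σ) h01 hrefl τ
    have key : ∀ {f : SpinConfig V → ℝ}, Measurable f →
        E P (fun σ => f (glue Λ σ (.fixed η₀))) τ =
          isingExpect G (Λ \ P) β h (.fixed (glue Λ τ (.fixed η₀))) f := by
      intro f hf
      have hdlr := sum_kernel_isingWeight_eq G hP β h η₀ (K := K P) (hK1 P) (hK0 P) τ hf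
      have h1 : ∑ σ, K P τ σ * w σ * f (glue Λ σ (.fixed η₀)) =
          (∑ σ, K P τ σ * W σ * f (glue Λ σ (.fixed η₀))) / Z := by
        rw [Finset.sum_div]
        exact Finset.sum_congr rfl fun σ _ => by simp only [hw]; ring
      have h2 : ∑ σ, K P τ σ * w σ = (∑ σ, K P τ σ * W σ) / Z := by
        rw [Finset.sum_div]
        exact Finset.sum_congr rfl fun σ _ => by simp only [hw]; ring
      rw [hEeq, h1, h2, div_div_div_cancel_right₀ hZpos.ne', hdlr, mul_div_cancel_left₀ _ hKW.ne']
    rw [← key hm1, ← key hm2]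
  have hsum : ∑ P ∈ Λ.powersetCard k, ∑ τ : Λ → ℤˣ, W τ / Z *
        (isingExpect G (Λ \ P) β h (.fixed (glue Λ τ (.fixed η₀))) (fun σ => (∑ x ∈ Λ, spinAt x σ) ^ 2) -
          isingExpect G (Λ \ P) β h (.fixed (glue Λ τ (.fixed η₀))) (fun σ => ∑ x ∈ Λ, spinAt x σ) ^ 2) =
      ∑ P ∈ Λ.powersetCard k, ∑ τ, w τ * (E P (fun τ => Mt τ ^ 2) τ - (E P Mt τ) ^ 2) :=
    Finset.sum_congr rfl fun P hP => Finset.sum_congr rfl fun τ _ => by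
      rw [hcv P (Finset.mem_powersetCard.1 hP).1 τ]
  -- denominators
  have hnk : (0 : ℝ) < (#Λ : ℝ) - k + 1 := by
    have : (k : ℝ) ≤ #Λ := by exact_mod_cast hkn
    linarith
  have hD : (0 : ℝ) < ((#Λ : ℝ) + 1) * ((#Λ : ℝ) - k + 1) := mul_pos (by positivity) hnk
  have hS : 0 ≤ ∑ P ∈ Λ.powersetCard k, ∑ τ, w τ * (E P (fun τ => Mt τ ^ 2) τ - (E P Mt τ) ^ 2) :=
    Finset.sum_nonneg fun P _ => hnonneg P
  rw [hsum]
  refine ⟨div_nonneg (mul_nonneg (Nat.cast_nonneg k) (div_nonneg hS (Nat.cast_nonneg _))) hD.le, ?_⟩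
  rw [div_le_one hD]
  exact hmain

/-- **`PinningEfficiencyLeOne`** (route `PlantedPinning`, item stmt-CriticalPhenomena-8455): for
all `L` and `1 ≤ k ≤ |box 3 L|`, the planted pinning efficiency `e_L(k)` of the critical
(`β = β_c(3)`, `h = 0`, `+` boundary condition) Ising box on `ℤ³` satisfies `0 ≤ e_L(k) ≤ 1` —
the pinning-lemma ceiling (Montanari 2008; Raghavendra–Tan 2012) transported through the
finite-volume DLR identity (Friedli–Velenik 2017, Lemma 6.7).  Instance of
`pinning_efficiency_bounds`. [folklore] -/
theorem pinningEfficiencyLeOne_proof : PinningEfficiencyLeOne := by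
  intro L k _hk hkn
  exact pinning_efficiency_bounds (zdGraph 3) (box 3 L) (criticalBeta 3) 0 1 hkn

end Summit.CriticalPhenomena.Ising3DConformalLimit.PlantedPinningCeiling
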